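import Mathlib.LinearAlgebra.ExteriorPower.Basic
import Mathlib.LinearAlgebra.Projection

/-!
# Venture HSemireg — the Weil generating set from TWO bidegree conditions: a 2-vector that is mixed for `V = P ⊕ Q`
# («`k`-bidegree `(1,1)`») and mixed for `V = M ⊕ L` («Hodge type `(1,1)`») lies in the span of the Weil generating set

HONEST FRAMING. Part of the Lean index of the computation cell `pub-hsemireg` (seat w3-mod4-1 gen 8, W3 SPECIAL FIBRES,
MOD4-OFFSPLIT §13: the last by-value input of THEOREM R_f / R on the carrier is the polarisation 2-vector `Θ` with the
hypothesis «`Θ ∈ span {ι x · ι l : (x ∈ P, l ∈ L ⊓ Q) or (x ∈ Q, l ∈ L ⊓ P)}`»). Finite-dimensional exterior / linear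
algebra over a field with `2 ≠ 0` ONLY: no variety, no cohomology theory, no semiregularity map; nothing here says that
HC / HC_CM / HC_AV holds; no Literature fact is declared or used; NO definition is introduced.

WHAT IS PROVED. For two decompositions `V = M ⊕ L` (IsCompl; «`H¹ = H^{1,0} ⊕ H^{0,1}`») and `P, Q ⊆ V` COMPATIBLE with it
(`P ≤ P ⊓ M ⊔ P ⊓ L`, `Q ≤ Q ⊓ M ⊔ Q ⊓ L`; «the `k`-eigenblocks are sums of their Hodge pieces», the tree's `eigenspace_eq_sup`):
(1) the REFLECTION `J = +1 on M, -1 on L` (Mathlib's `LinearMap.ofIsCompl hML M.subtype (-L.subtype)`, written out) acts on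
the span of the SAME-type products `ι a · ι b` (`a, b ∈ M` or `a, b ∈ L`) by `+1` and on the MIXED products (`a ∈ M, b ∈ L` or
`a ∈ L, b ∈ M`) by `-1` (`map_refl_eq_self_of_mem_same`, `map_refl_eq_neg_of_mem_mixed`); every `x ∈ ⋀² V` is same + mixed
(`exists_same_add_mixed`), so **`ΛJ x = -x ⇒ x` is in the mixed span** (`mem_mixed_of_map_refl_eq_neg`) — the projection trick,
no independence of the pieces needed; (2) a product `ι a · ι b` with `a ∈ P`, `b ∈ Q` splits along `M ⊕ L` into a same-type part
and a part in the span of the WEIL GENERATING SET `{ι x · ι l : (x ∈ P, l ∈ L ⊓ Q) or (x ∈ Q, l ∈ L ⊓ P)}`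
(`exists_same_add_weilGen_of_mem_mixed`); hence **a 2-vector mixed for `(P, Q)` AND mixed for `(M, L)` lies in the span of the
Weil generating set** (`mem_span_weilGen_of_mixed_of_mixed`). On a polarised Weil-type abelian variety this is exactly
«`h` of Hodge type `(1,1)` with `φ^* h = d·h` ⇒ `h ∈ H^{1,0}_+ ⊗ H^{0,1}_- ⊕ H^{1,0}_- ⊗ H^{0,1}_+`» (sequel, real carriers).
References: [BourbakiAlgebre1a3] Ch. III §7 no. 1–2 (functoriality of `⋀`, degree-2 elements are sums of products).
-/

noncomputable section

open ExteriorAlgebra (ι)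
open Module

namespace Summit.Ventures.HSemireg.WeilFrame

variable {K : Type*} [Field K] {V : Type*} [AddCommGroup V] [Module K V]

/-! ### 1. The reflection of a decomposition `V = M ⊕ L` and its action on degree-2 products -/

section Reflection

variable {M L : Submodule K V} (hML : IsCompl M L)

/-- the reflection is `+1` on `M`. -/
lemma refl_apply_of_mem_left {u : V} (hu : u ∈ M) : LinearMap.ofIsCompl hML M.subtype (-L.subtype) u = u :=
  LinearMap.ofIsCompl_apply_left hML ⟨u, hu⟩

/-- the reflection is `-1` on `L`. -/
lemma refl_apply_of_mem_right {v : V} (hv : v ∈ L) : LinearMap.ofIsCompl hML M.subtype (-L.subtype) v = -v :=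
  LinearMap.ofIsCompl_apply_right hML ⟨v, hv⟩

/-- **`ΛJ` fixes the same-type products** `ι a · ι b`, `a, b ∈ M` or `a, b ∈ L`, and their span.
[cite: BourbakiAlgebre1a3, Ch. III §7 no. 2] -/
theorem map_refl_eq_self_of_mem_same {x : ExteriorAlgebra K V}
    (hx : x ∈ Submodule.span K {z : ExteriorAlgebra K V |
      ∃ a b : V, ((a ∈ M ∧ b ∈ M) ∨ (a ∈ L ∧ b ∈ L)) ∧ z = ι K a * ι K b}) :
    ExteriorAlgebra.map (LinearMap.ofIsCompl hML M.subtype (-L.subtype)) x = x := by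
  induction hx using Submodule.span_induction with
  | mem z hz =>
    obtain ⟨a, b, hab, rfl⟩ := hz
    rw [map_mul, ExteriorAlgebra.map_apply_ι, ExteriorAlgebra.map_apply_ι]
    rcases hab with ⟨ha, hb⟩ | ⟨ha, hb⟩
    · rw [refl_apply_of_mem_left hML ha, refl_apply_of_mem_left hML hb]
    · rw [refl_apply_of_mem_right hML ha, refl_apply_of_mem_right hML hb, map_neg, map_neg, neg_mul_neg]
  | zero => rw [map_zero]
  | add x y _ _ hx hy => rw [map_add, hx, hy]
  | smul t x _ hx => rw [map_smul, hx]

/-- **`ΛJ` negates the mixed products** `ι a · ι b`, `a ∈ M, b ∈ L` or `a ∈ L, b ∈ M`, and their span.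
[cite: BourbakiAlgebre1a3, Ch. III §7 no. 2] -/
theorem map_refl_eq_neg_of_mem_mixed {x : ExteriorAlgebra K V}
    (hx : x ∈ Submodule.span K {z : ExteriorAlgebra K V |
      ∃ a b : V, ((a ∈ M ∧ b ∈ L) ∨ (a ∈ L ∧ b ∈ M)) ∧ z = ι K a * ι K b}) :
    ExteriorAlgebra.map (LinearMap.ofIsCompl hML M.subtype (-L.subtype)) x = -x := by
  induction hx using Submodule.span_induction with
  | mem z hz =>
    obtain ⟨a, b, hab, rfl⟩ := hz
    rw [map_mul, ExteriorAlgebra.map_apply_ι, ExteriorAlgebra.map_apply_ι]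
    rcases hab with ⟨ha, hb⟩ | ⟨ha, hb⟩
    · rw [refl_apply_of_mem_left hML ha, refl_apply_of_mem_right hML hb, map_neg, mul_neg]
    · rw [refl_apply_of_mem_right hML ha, refl_apply_of_mem_left hML hb, map_neg, neg_mul]
  | zero => rw [map_zero, neg_zero]
  | add x y _ _ hx hy => rw [map_add, hx, hy, neg_add]
  | smul t x _ hx => rw [map_smul, hx, smul_neg]

/-- **every element of `⋀² V` is a same-type part plus a mixed part** along `V = M ⊕ L` (expand each product `ι u · ι v` after
`u = u_M + u_L`, `v = v_M + v_L`). [cite: BourbakiAlgebre1a3, Ch. III §7 no. 1] -/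
theorem exists_same_add_mixed (hML : IsCompl M L) {x : ExteriorAlgebra K V} (hx : x ∈ ⋀[K]^2 V) :
    ∃ y ∈ Submodule.span K {z : ExteriorAlgebra K V | ∃ a b : V, ((a ∈ M ∧ b ∈ M) ∨ (a ∈ L ∧ b ∈ L)) ∧ z = ι K a * ι K b},
      ∃ w ∈ Submodule.span K {z : ExteriorAlgebra K V | ∃ a b : V, ((a ∈ M ∧ b ∈ L) ∨ (a ∈ L ∧ b ∈ M)) ∧ z = ι K a * ι K b},
        x = y + w := by
  set S := Submodule.span K {z : ExteriorAlgebra K V | ∃ a b : V, ((a ∈ M ∧ b ∈ M) ∨ (a ∈ L ∧ b ∈ L)) ∧ z = ι K a * ι K b}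
  set T := Submodule.span K {z : ExteriorAlgebra K V | ∃ a b : V, ((a ∈ M ∧ b ∈ L) ∨ (a ∈ L ∧ b ∈ M)) ∧ z = ι K a * ι K b}
  rw [← ExteriorAlgebra.ιMulti_span_fixedDegree] at hx
  induction hx using Submodule.span_induction with
  | mem z hz =>
    obtain ⟨v, rfl⟩ := hz
    -- decompose the two factors along `M ⊕ L`
    have hdec : ∀ u : V, ∃ a ∈ M, ∃ b ∈ L, u = a + b := fun u => by
      have hu : u ∈ M ⊔ L := by rw [hML.sup_eq_top]; exact Submodule.mem_top
      obtain ⟨a, ha, b, hb, hab⟩ := Submodule.mem_sup.mp hu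
      exact ⟨a, ha, b, hb, hab.symm⟩
    obtain ⟨a₀, ha₀, b₀, hb₀, h₀⟩ := hdec (v 0)
    obtain ⟨a₁, ha₁, b₁, hb₁, h₁⟩ := hdec (v 1)
    have hz : ExteriorAlgebra.ιMulti K 2 v = ι K (v 0) * ι K (v 1) := by
      rw [ExteriorAlgebra.ιMulti_apply]; simp [List.ofFn_succ]
    refine ⟨ι K a₀ * ι K a₁ + ι K b₀ * ι K b₁, ?_, ι K a₀ * ι K b₁ + ι K b₀ * ι K a₁, ?_, ?_⟩
    · exact S.add_mem (Submodule.subset_span ⟨a₀, a₁, Or.inl ⟨ha₀, ha₁⟩, rfl⟩)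
        (Submodule.subset_span ⟨b₀, b₁, Or.inr ⟨hb₀, hb₁⟩, rfl⟩)
    · exact T.add_mem (Submodule.subset_span ⟨a₀, b₁, Or.inl ⟨ha₀, hb₁⟩, rfl⟩)
        (Submodule.subset_span ⟨b₀, a₁, Or.inr ⟨hb₀, ha₁⟩, rfl⟩)
    · rw [hz, h₀, h₁, map_add, map_add, add_mul, mul_add, mul_add]; abel
  | zero => exact ⟨0, S.zero_mem, 0, T.zero_mem, (add_zero 0).symm⟩
  | add x x' _ _ hx hx' =>
    obtain ⟨y, hy, w, hw, rfl⟩ := hx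
    obtain ⟨y', hy', w', hw', rfl⟩ := hx'
    exact ⟨y + y', S.add_mem hy hy', w + w', T.add_mem hw hw', by abel⟩
  | smul t x _ hx =>
    obtain ⟨y, hy, w, hw, rfl⟩ := hx
    exact ⟨t • y, S.smul_mem t hy, t • w, T.smul_mem t hw, by rw [smul_add]⟩

/-- **the projection trick:** if `2 ≠ 0` in `K`, an element of `⋀² V` on which the reflection `ΛJ` of `V = M ⊕ L` acts by `-1`
lies in the span of the MIXED products (`x = y + w`, `ΛJ x = y - w = -y - w` forces `2y = 0`).
[cite: BourbakiAlgebre1a3, Ch. III §7 no. 2] -/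
theorem mem_mixed_of_map_refl_eq_neg (h2 : (2 : K) ≠ 0) {x : ExteriorAlgebra K V} (hx : x ∈ ⋀[K]^2 V)
    (hJ : ExteriorAlgebra.map (LinearMap.ofIsCompl hML M.subtype (-L.subtype)) x = -x) :
    x ∈ Submodule.span K {z : ExteriorAlgebra K V | ∃ a b : V, ((a ∈ M ∧ b ∈ L) ∨ (a ∈ L ∧ b ∈ M)) ∧ z = ι K a * ι K b} := by
  obtain ⟨y, hy, w, hw, rfl⟩ := exists_same_add_mixed hML hx
  rw [map_add, map_refl_eq_self_of_mem_same hML hy, map_refl_eq_neg_of_mem_mixed hML hw, neg_add, add_left_inj] at hJ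
  -- `y = -y` ⇒ `y = 0`
  have hy0 : y = 0 := by
    have h : (2 : K) • y = 0 := by rw [two_smul]; nth_rewrite 2 [hJ]; rw [add_neg_cancel]
    exact (smul_eq_zero.mp h).resolve_left h2
  rw [hy0, zero_add]
  exact hw

end Reflection

/-! ### 2. Two compatible decompositions: mixed for `(P, Q)` and mixed for `(M, L)` ⇒ in the span of the Weil generating set -/

/-- a mixed product for `(P, Q)` splits along `M ⊕ L` into a SAME-type part (`M`-`M` and `L`-`L` products) and a part in the
span of the REFINED Weil generators `ι a · ι l` with `(a ∈ P ⊓ M, l ∈ L ⊓ Q)` or `(a ∈ Q ⊓ M, l ∈ L ⊓ P)` (which are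
`(M, L)`-mixed), provided `P`, `Q` are sums of their `M`- and `L`-pieces. [cite: BourbakiAlgebre1a3, Ch. III §7 no. 1] -/
theorem exists_same_add_weilGen_of_mem_mixed {M L P Q : Submodule K V} (hP : P ≤ P ⊓ M ⊔ P ⊓ L) (hQ : Q ≤ Q ⊓ M ⊔ Q ⊓ L)
    {x : ExteriorAlgebra K V}
    (hx : x ∈ Submodule.span K {z : ExteriorAlgebra K V | ∃ a b : V, ((a ∈ P ∧ b ∈ Q) ∨ (a ∈ Q ∧ b ∈ P)) ∧ z = ι K a * ι K b}) :
    ∃ y ∈ Submodule.span K {z : ExteriorAlgebra K V | ∃ a b : V, ((a ∈ M ∧ b ∈ M) ∨ (a ∈ L ∧ b ∈ L)) ∧ z = ι K a * ι K b},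
      ∃ w ∈ Submodule.span K {z : ExteriorAlgebra K V |
          ∃ a l : V, ((a ∈ P ⊓ M ∧ l ∈ L ⊓ Q) ∨ (a ∈ Q ⊓ M ∧ l ∈ L ⊓ P)) ∧ z = ι K a * ι K l},
        x = y + w := by
  set S := Submodule.span K {z : ExteriorAlgebra K V | ∃ a b : V, ((a ∈ M ∧ b ∈ M) ∨ (a ∈ L ∧ b ∈ L)) ∧ z = ι K a * ι K b}
  set G := Submodule.span K {z : ExteriorAlgebra K V |
    ∃ a l : V, ((a ∈ P ⊓ M ∧ l ∈ L ⊓ Q) ∨ (a ∈ Q ⊓ M ∧ l ∈ L ⊓ P)) ∧ z = ι K a * ι K l}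
  -- one ordered product `ι a · ι b`, `a ∈ P`, `b ∈ Q`
  have hgen : ∀ a ∈ P, ∀ b ∈ Q, ∃ y ∈ S, ∃ w ∈ G, ι K a * ι K b = y + w := by
    intro a ha b hb
    obtain ⟨a₁, ha₁, a₂, ha₂, haa⟩ := Submodule.mem_sup.mp (hP ha)
    obtain ⟨b₁, hb₁, b₂, hb₂, hbb⟩ := Submodule.mem_sup.mp (hQ hb)
    have hswap : ι K a₂ * ι K b₁ = -(ι K b₁ * ι K a₂) := eq_neg_of_add_eq_zero_left (ExteriorAlgebra.ι_add_mul_swap _ _)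
    refine ⟨ι K a₁ * ι K b₁ + ι K a₂ * ι K b₂, ?_, ι K a₁ * ι K b₂ + ι K a₂ * ι K b₁, ?_, ?_⟩
    · exact S.add_mem (Submodule.subset_span ⟨a₁, b₁, Or.inl ⟨ha₁.2, hb₁.2⟩, rfl⟩)
        (Submodule.subset_span ⟨a₂, b₂, Or.inr ⟨ha₂.2, hb₂.2⟩, rfl⟩)
    · refine G.add_mem (Submodule.subset_span ⟨a₁, b₂, Or.inl ⟨ha₁, hb₂.2, hb₂.1⟩, rfl⟩) ?_
      rw [hswap]
      exact G.neg_mem (Submodule.subset_span ⟨b₁, a₂, Or.inr ⟨hb₁, ha₂.2, ha₂.1⟩, rfl⟩)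
    · rw [← haa, ← hbb, map_add, map_add, add_mul, mul_add, mul_add]; abel
  induction hx using Submodule.span_induction with
  | mem z hz =>
    obtain ⟨a, b, hab, rfl⟩ := hz
    rcases hab with ⟨ha, hb⟩ | ⟨ha, hb⟩
    · exact hgen a ha b hb
    · obtain ⟨y, hy, w, hw, h⟩ := hgen b hb a ha
      have hswap : ι K a * ι K b = -(ι K b * ι K a) := eq_neg_of_add_eq_zero_left (ExteriorAlgebra.ι_add_mul_swap _ _)
      exact ⟨-y, S.neg_mem hy, -w, G.neg_mem hw, by rw [hswap, h, neg_add]⟩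
  | zero => exact ⟨0, S.zero_mem, 0, G.zero_mem, (add_zero 0).symm⟩
  | add x x' _ _ hx hx' =>
    obtain ⟨y, hy, w, hw, rfl⟩ := hx
    obtain ⟨y', hy', w', hw', rfl⟩ := hx'
    exact ⟨y + y', S.add_mem hy hy', w + w', G.add_mem hw hw', by abel⟩
  | smul t x _ hx =>
    obtain ⟨y, hy, w, hw, rfl⟩ := hx
    exact ⟨t • y, S.smul_mem t hy, t • w, G.smul_mem t hw, by rw [smul_add]⟩

/-- the refined Weil generators are `(M, L)`-mixed, so the reflection of `M ⊕ L` negates their span. -/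
theorem map_refl_eq_neg_of_mem_span_refined {M L P Q : Submodule K V} (hML : IsCompl M L) {w : ExteriorAlgebra K V}
    (hw : w ∈ Submodule.span K {z : ExteriorAlgebra K V |
      ∃ a l : V, ((a ∈ P ⊓ M ∧ l ∈ L ⊓ Q) ∨ (a ∈ Q ⊓ M ∧ l ∈ L ⊓ P)) ∧ z = ι K a * ι K l}) :
    ExteriorAlgebra.map (LinearMap.ofIsCompl hML M.subtype (-L.subtype)) w = -w := by
  refine map_refl_eq_neg_of_mem_mixed hML (Submodule.span_mono ?_ hw)
  rintro _ ⟨a, l, hal, rfl⟩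
  rcases hal with ⟨ha, hl⟩ | ⟨ha, hl⟩
  · exact ⟨a, l, Or.inl ⟨ha.2, hl.1⟩, rfl⟩
  · exact ⟨a, l, Or.inl ⟨ha.2, hl.1⟩, rfl⟩

/-- the refined Weil generators lie in the Weil generating set of `(L; P, Q)`. -/
theorem span_refined_le_span_weilGen {M L P Q : Submodule K V} :
    Submodule.span K {z : ExteriorAlgebra K V |
        ∃ a l : V, ((a ∈ P ⊓ M ∧ l ∈ L ⊓ Q) ∨ (a ∈ Q ⊓ M ∧ l ∈ L ⊓ P)) ∧ z = ι K a * ι K l} ≤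
      Submodule.span K {z : ExteriorAlgebra K V |
        ∃ a l : V, ((a ∈ P ∧ l ∈ L ⊓ Q) ∨ (a ∈ Q ∧ l ∈ L ⊓ P)) ∧ z = ι K a * ι K l} := by
  refine Submodule.span_mono ?_
  rintro _ ⟨a, l, hal, rfl⟩
  rcases hal with ⟨ha, hl⟩ | ⟨ha, hl⟩
  · exact ⟨a, l, Or.inl ⟨ha.1, hl⟩, rfl⟩
  · exact ⟨a, l, Or.inr ⟨ha.1, hl⟩, rfl⟩

/-- **mixed for `(P, Q)` and mixed for `(M, L)` ⇒ in the span of the WEIL GENERATING SET** (`2 ≠ 0`; `P`, `Q` compatible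
with `V = M ⊕ L`): write `x = y + w` with `y` same-type and `w` refined-Weil (`(M,L)`-mixed); the reflection gives
`-x = ΛJ x = y - w`, so `2y = 0` and `x = w`. [cite: BourbakiAlgebre1a3, Ch. III §7 no. 1–2] -/
theorem mem_span_weilGen_of_mixed_of_mixed {M L P Q : Submodule K V} (hML : IsCompl M L) (h2 : (2 : K) ≠ 0)
    (hP : P ≤ P ⊓ M ⊔ P ⊓ L) (hQ : Q ≤ Q ⊓ M ⊔ Q ⊓ L) {x : ExteriorAlgebra K V}
    (hxPQ : x ∈ Submodule.span K {z : ExteriorAlgebra K V |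
      ∃ a b : V, ((a ∈ P ∧ b ∈ Q) ∨ (a ∈ Q ∧ b ∈ P)) ∧ z = ι K a * ι K b})
    (hxML : x ∈ Submodule.span K {z : ExteriorAlgebra K V |
      ∃ a b : V, ((a ∈ M ∧ b ∈ L) ∨ (a ∈ L ∧ b ∈ M)) ∧ z = ι K a * ι K b}) :
    x ∈ Submodule.span K {z : ExteriorAlgebra K V |
      ∃ a l : V, ((a ∈ P ∧ l ∈ L ⊓ Q) ∨ (a ∈ Q ∧ l ∈ L ⊓ P)) ∧ z = ι K a * ι K l} := by
  obtain ⟨y, hy, w, hw, hxyw⟩ := exists_same_add_weilGen_of_mem_mixed hP hQ hxPQ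
  have hJ := map_refl_eq_neg_of_mem_mixed hML hxML
  rw [hxyw, map_add, map_refl_eq_self_of_mem_same hML hy, map_refl_eq_neg_of_mem_span_refined hML hw, neg_add,
    add_left_inj] at hJ
  have hy0 : y = 0 := by
    have h : (2 : K) • y = 0 := by rw [two_smul]; nth_rewrite 2 [hJ]; rw [add_neg_cancel]
    exact (smul_eq_zero.mp h).resolve_left h2
  rw [hxyw, hy0, zero_add]
  exact span_refined_le_span_weilGen hw

end Summit.Ventures.HSemireg.WeilFrame

end
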